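import Literature.AlgebraicGeometry.Resolution.KnafKuhlmann2009Assembly
import Literature.AlgebraicGeometry.Resolution.LocalUniformizationEssFiniteType
import Literature.AlgebraicGeometry.Resolution.LocalUniformization
import Literature.AlgebraicGeometry.Resolution.NormalizationFractions
import Literature.AlgebraicGeometry.Resolution.SubfieldTransport
import Summits.ResolutionOfSingularities.ResolutionOfSingularities.Theorems.AbhyankarShadowsShadowsUniformizeLurelDiscreteAmbient
import Summits.ResolutionOfSingularities.ResolutionOfSingularities.Theorems.AbhyankarShadowsShadowsUniformizePullback
import HarnessLib

/-!
# Relative local uniformization at discrete rational places (Knaf–Kuhlmann 2009, Thm. 1.5): the discrete branch of `ShadowsUniformize`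

Line `birth` of the crux `ShadowsUniformize` (stmt-ResolutionOfSingularities-16756, route
`AbhyankarShadows`), DISCRETE BRANCH, typed half (lead c1): the pull-back of the ambient theorem
`knafKuhlmann2009_thm15_discrete` (`AbhyankarShadowsShadowsUniformizeLurelDiscreteAmbient.lean`)
to the crux's / the route target `LurelRational`'s conclusion, with the landed `stub_pullback`.

On the identity-shadow locus isolated by the standing disprover — rational valuation rings `O` of
`K/k` (`k` algebraically closed of characteristic `p`, `K/k` finitely generated) whose value group
is CYCLIC, i.e. discrete rational places — the shadow hypothesis of the crux is free, and the crux
there is plain relative local uniformization. These places are NOT Abhyankar as soon as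
`trdeg K/k ≥ 2`, but `K` lies in the completion `k((t))` of the Abhyankar subfield `k(t)` of a
uniformizer `t`, and Knaf–Kuhlmann 2009, Thm. 1.5 applies:

* `lurel_of_forall_valuation_eq_one` — the degenerate case `O = K` (`lurel_of_essFiniteType`);
* `exists_uniformizer_of_isCyclic` — a uniformizer `t` (`0 < v t < 1`, all non-zero values integer
  powers of `v t`) from `IsCyclic (O.ValueGroup)ˣ`;
* `lurelRational_of_isCyclic_valueGroup` — **the typed statement**: under the hypotheses of
  `LurelRational` plus `IsCyclic (O.ValueGroup)ˣ`, some finitely generated `A`, `R ≤ A ⊆ O`,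
  `Frac A = K`, is regular at the centre of `O` (embed `K ↪ Ω = K̄`, extend `O` to `V` by
  Chevalley, transport finite generation / rationality / discreteness, apply the ambient theorem,
  pass to the field base, pull back with `stub_pullback`).

No named facts are used.

## Sources

* [KK09] H. Knaf, F.-V. Kuhlmann, *Every place admits local uniformization in a finite extension
  of the function field*, Adv. Math. 221 (2009) 428–453 = arXiv:math/0702856: Thm. 1.5 (p. 5),
  §3.4 (pp. 14–15 of the arXiv PDF). [KnafKuhlmann2009]
-/

noncomputable section

-- single-problem summit: the doubled namespace component is forced
set_option linter.dupNamespace false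

open Literature.AlgebraicGeometry.Resolution IsLocalRing

namespace Summit.ResolutionOfSingularities.ResolutionOfSingularities.Theorems

/-- **Degenerate case: the trivial valuation ring.** If every non-zero element of `K` has value
`1` then `O = K` is a localisation of any affine model `B` of `K/k`, and relative local
uniformization is free (`lurel_of_essFiniteType`). [folklore] -/
theorem lurel_of_forall_valuation_eq_one {k K : Type} [Field k] [Field K] [Algebra k K]
    (hfg : (⊤ : IntermediateField k K).FG) (O : ValuationSubring K)
    (hk : ∀ c : k, algebraMap k K c ∈ O) (htriv : ∀ x : K, x ≠ 0 → O.valuation x = 1)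
    (R : Subalgebra k K) (hR : R.FG) (hRO : R.toSubring ≤ O.toSubring) :
    ∃ (A : Subalgebra k K) (h : A.toSubring ≤ O.toSubring), R ≤ A ∧ A.FG ∧
      IsFractionRing A K ∧ IsRegularLocalRing
        (Localization.AtPrime (Ideal.comap (Subring.inclusion h) (IsLocalRing.maximalIdeal O))) := by
  classical
  obtain ⟨B, hBO, hBfg, hBfrac⟩ := exists_affineModel k K hfg O hk
  haveI := hBfrac
  have hmemO : ∀ x : K, x ∈ O := by
    intro x
    by_cases hx : x = 0
    · rw [hx]; exact O.zero_mem
    · exact (O.valuation_le_one_iff x).mp (htriv x hx).le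
  have hloc : ∀ x : K, x ∈ O → ∃ b ∈ B, ∃ s ∈ B, s ≠ 0 ∧ s⁻¹ ∈ O ∧ x = b * s⁻¹ := by
    intro x _
    obtain ⟨a, s, hs, hx⟩ := IsFractionRing.div_surjective (A := B) x
    have hs0 : (s : K) ≠ 0 := by
      have := nonZeroDivisors.ne_zero hs
      exact fun h => this (Subtype.ext h)
    refine ⟨a, a.2, s, s.2, hs0, hmemO _, ?_⟩
    rw [← hx, div_eq_mul_inv]
    rfl
  obtain ⟨A, hAO, hRA, hBA, hAfg, hreg⟩ := lurel_of_essFiniteType O B hBfg hBO hloc R hR hRO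
  refine ⟨A, hAO, hRA, hAfg, ?_, hreg⟩
  refine isFractionRing_of_forall_exists_div A.toSubring fun z => ?_
  obtain ⟨a, s, _, hz⟩ := IsFractionRing.div_surjective (A := B) z
  exact ⟨a, hBA a.2, s, hBA s.2, by rw [← hz]; rfl⟩

/-- **A uniformizer from a cyclic value group.** If `(O.ValueGroup)ˣ` is cyclic and `O ≠ K`,
there is `t ∈ K` with `0 < v t < 1` such that every non-zero value is an integer power of
`v t`. [folklore] -/
theorem exists_uniformizer_of_isCyclic {K : Type} [Field K] (O : ValuationSubring K)
    (hcyc : IsCyclic (O.ValueGroup)ˣ) (hnt : ∃ x : K, x ≠ 0 ∧ O.valuation x ≠ 1) :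
    ∃ t : K, t ≠ 0 ∧ O.valuation t < 1 ∧
      ∀ y : K, y ≠ 0 → ∃ m : ℤ, O.valuation y = O.valuation t ^ m := by
  obtain ⟨g, hg⟩ := hcyc.exists_generator
  -- the generator is not `1`
  have hg1 : (g : O.ValueGroup) ≠ 1 := by
    intro h1
    obtain ⟨x, hx0, hx1⟩ := hnt
    have hu : Units.mk0 (O.valuation x) ((map_ne_zero O.valuation).mpr hx0) ∈ Subgroup.zpowers g :=
      hg _
    obtain ⟨m, hm⟩ := Subgroup.mem_zpowers_iff.mp hu
    apply hx1
    have := congrArg Units.val hm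
    rw [Units.val_zpow_eq_zpow_val, h1, one_zpow] at this
    simpa using this.symm
  -- normalise the generator below `1`
  obtain ⟨u, hu1, hugen⟩ : ∃ u : (O.ValueGroup)ˣ, (u : O.ValueGroup) < 1 ∧
      ∀ w : (O.ValueGroup)ˣ, w ∈ Subgroup.zpowers u := by
    rcases lt_or_gt_of_ne hg1 with hlt | hgt
    · exact ⟨g, hlt, hg⟩
    · refine ⟨g⁻¹, ?_, fun w => ?_⟩
      · rw [Units.val_inv_eq_inv_val]
        exact inv_lt_one_of_one_lt₀ hgt
      · rw [Subgroup.zpowers_inv]; exact hg w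
  obtain ⟨t, ht⟩ := O.valuation_surjective (u : O.ValueGroup)
  have ht0 : t ≠ 0 := by
    intro h0
    rw [h0, map_zero] at ht
    exact u.ne_zero ht.symm
  refine ⟨t, ht0, ht ▸ hu1, fun y hy0 => ?_⟩
  obtain ⟨m, hm⟩ := Subgroup.mem_zpowers_iff.mp
    (hugen (Units.mk0 (O.valuation y) ((map_ne_zero O.valuation).mpr hy0)))
  refine ⟨m, ?_⟩
  have := congrArg Units.val hm
  rw [Units.val_zpow_eq_zpow_val] at this
  rw [ht]
  simpa using this.symm


/-- **Relative local uniformization at discrete rational places** (the discrete branch of the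
crux `ShadowsUniformize`; = the route target `LurelRational` restricted to cyclic value groups):
for `k` algebraically closed of characteristic `p`, `K/k` finitely generated, `O ∋ k` a valuation
ring of `K` with every element congruent to a constant and with CYCLIC value group, and `R ⊆ O`
finitely generated, there is a finitely generated `A` with `R ≤ A ⊆ O`, `Frac A = K`, whose
localisation at the centre `𝔪_O ∩ A` is a regular local ring. `O = K` is the degenerate case;
otherwise take a uniformizer (`exists_uniformizer_of_isCyclic`), embed `K ↪ Ω = K̄`, extend `O` to
`V` (`exists_valuationSubring_comap_eq`), transport finite generation, rationality and
discreteness to `k' ≤ K' ≤ Ω`, apply `knafKuhlmann2009_thm15_discrete`, pass to the field base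
(`isSmoothlyUniformizableIn_inf_iff`) and pull back (`stub_pullback`).
[cite: KnafKuhlmann2009, Thm. 1.5] -/
theorem lurelRational_of_isCyclic_valueGroup :
    ∀ p : ℕ, p.Prime → ∀ (k K : Type) [Field k] [CharP k p] [IsAlgClosed k] [Field K]
    [Algebra k K], (⊤ : IntermediateField k K).FG → ∀ O : ValuationSubring K,
    (∀ c : k, algebraMap k K c ∈ O) →
    (∀ x : K, x ∈ O → ∃ c : k, O.valuation (x - algebraMap k K c) < 1) →
    IsCyclic (O.ValueGroup)ˣ →
    ∀ R : Subalgebra k K, R.FG → R.toSubring ≤ O.toSubring →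
    ∃ (A : Subalgebra k K) (h : A.toSubring ≤ O.toSubring), R ≤ A ∧ A.FG ∧
      IsFractionRing A K ∧ IsRegularLocalRing
        (Localization.AtPrime (Ideal.comap (Subring.inclusion h) (IsLocalRing.maximalIdeal O))) := by
  intro p hp k K _ _ _ _ _ hfg O hk hrat hcyc R hR hRO
  classical
  by_cases hnt : ∃ x : K, x ≠ 0 ∧ O.valuation x ≠ 1
  swap
  · push Not at hnt
    exact lurel_of_forall_valuation_eq_one hfg O hk hnt R hR hRO
  obtain ⟨t, ht0, ht1, hdisc⟩ := exists_uniformizer_of_isCyclic O hcyc hnt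
  -- ambient data: `Ω = K̄`, `V` over `O`
  let Ω : Type := AlgebraicClosure K
  obtain ⟨V, hV⟩ := exists_valuationSubring_comap_eq (Ω := Ω) O
  subst hV
  set ι : K →+* Ω := algebraMap K Ω with hιdef
  set k' : Subfield Ω := (algebraMap k Ω).fieldRange with hk'def
  set K' : Subfield Ω := ι.fieldRange with hK'def
  have hιk : ∀ c : k, ι (algebraMap k K c) = algebraMap k Ω c := fun c =>
    (IsScalarTower.algebraMap_apply k K Ω c).symm
  have hmemV : ∀ z : K, ι z ∈ V ↔ z ∈ V.comap ι := fun z => ValuationSubring.mem_comap.symm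
  have hlt1 : ∀ z : K, V.valuation (ι z) < 1 ↔ (V.comap ι).valuation z < 1 := fun z =>
    (comap_valuation_lt_one_iff V ι z).symm
  have heq1 : ∀ z : K, z ∈ V.comap ι → (V.valuation (ι z) = 1 ↔ (V.comap ι).valuation z = 1) :=
    fun z hz => (comap_valuation_eq_one_iff V ι hz).symm
  have hkK : k' ≤ K' := by
    rintro _ ⟨c, rfl⟩
    exact ⟨algebraMap k K c, hιk c⟩
  have hkV : (k' : Set Ω) ⊆ V := by
    rintro _ ⟨c, rfl⟩
    rw [← hιk]
    exact (hmemV _).mpr (hk c)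
  have htK' : ι t ∈ K' := ⟨t, rfl⟩
  have hιt0 : ι t ≠ 0 := (map_ne_zero ι).mpr ht0
  have ht1' : V.valuation (ι t) < 1 := (hlt1 t).mpr ht1
  have hdisc' : ∀ y ∈ K', y ≠ 0 → ∃ m : ℤ, V.valuation y = V.valuation (ι t) ^ m := by
    rintro _ ⟨y, rfl⟩ hy0
    have hy0' : y ≠ 0 := fun h => hy0 (by rw [h, map_zero])
    obtain ⟨m, hm⟩ := hdisc y hy0'
    refine ⟨m, ?_⟩
    have h1 : (V.comap ι).valuation (y / t ^ m) = 1 := by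
      rw [map_div₀, map_zpow₀, ← hm, div_self ((map_ne_zero _).mpr hy0')]
    have hmem : y / t ^ m ∈ V.comap ι := ((V.comap ι).valuation_le_one_iff _).mp h1.le
    have h2 : V.valuation (ι (y / t ^ m)) = 1 := (heq1 _ hmem).mpr h1
    rwa [map_div₀, map_div₀, map_zpow₀, map_zpow₀,
      div_eq_one_iff_eq (zpow_ne_zero m ((map_ne_zero _).mpr hιt0))] at h2
  have hrat' : ∀ y ∈ K', y ∈ V → ∃ c ∈ k', V.valuation (y - c) < 1 := by
    rintro _ ⟨y, rfl⟩ hyV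
    obtain ⟨c, hc⟩ := hrat y ((hmemV y).mp hyV)
    refine ⟨algebraMap k Ω c, ⟨c, rfl⟩, ?_⟩
    rw [← hιk, ← map_sub]
    exact (hlt1 _).mpr hc
  have hfgΩ : FGOver k' K' := by
    set K₀ : Subfield K := (algebraMap k K).fieldRange with hK₀
    have hfg₀ : FGOver K₀ (⊤ : Subfield K) := by
      obtain ⟨s, hs⟩ := hfg
      refine ⟨s, ?_⟩
      have h1 : (IntermediateField.adjoin k (s : Set K)).toSubfield =
          Subfield.closure (Set.range (algebraMap k K) ∪ (s : Set K)) := rfl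
      rw [RingHom.coe_fieldRange, ← h1, hs]
      rfl
    have h := fgOver_map ι hfg₀
    have hk'eq : K₀.map ι = k' := by
      ext z
      simp only [Subfield.mem_map, RingHom.mem_fieldRange, hK₀]
      constructor
      · rintro ⟨_, ⟨c, rfl⟩, rfl⟩; exact ⟨c, (hιk c).symm⟩
      · rintro ⟨c, rfl⟩; exact ⟨_, ⟨c, rfl⟩, hιk c⟩
    have hK'eq : (⊤ : Subfield K).map ι = K' := by
      rw [hK'def, RingHom.fieldRange_eq_map]
    rwa [hk'eq, hK'eq] at h
  haveI : IsAlgClosed k' := IsAlgClosed.of_ringEquiv k k' (algebraMap k Ω).rangeRestrictFieldEquiv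
  haveI : PerfectField k' := inferInstance
  have hSU : ∀ Z : Finset Ω, (∀ z ∈ Z, z ∈ V ∧ z ∈ K') →
      IsSmoothlyUniformizableIn k' V K' (Z : Set Ω) := fun Z hZ =>
    (isSmoothlyUniformizableIn_inf_iff V k' hkV K' _).mp
      (knafKuhlmann2009_thm15_discrete V k' K' (ι t) hkK hfgΩ hkV htK' hιt0 ht1' hrat' hdisc' Z hZ)
  exact stub_pullback k K Ω (V.comap ι) V rfl hk R hR hRO hSU

end Summit.ResolutionOfSingularities.ResolutionOfSingularities.Theorems

end
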